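import Summits.QuantumFields.BalabanUV.T4Continuum.Spine.NE1p.DressedJointAnalyticOnCores
import Summits.QuantumFields.BalabanUV.T4Continuum.Spine.NE1p.DressedSourceAnalyticWitness

/-!
# T⁴ programme, spine estimate NE1′ (node O3b/H2) — WITNESS W54 «THE JOINT FACE FIRES WITH LIVE OPERATOR LETTERS», PART 1:
# S42's `differentiableOn_termAt_joint` and `termLineAnalytic_termAt` APPLIED ONCE EACH BY NAME on a decided (2.14)-core of the
# format of record whose Gaussian LETTERS DEPEND ON THE OPERATOR DATUM; GENUINE: the term at table `0` is NOT constant in the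
# operator datum inside the class ball — row NE5's `TermLineAnalytic` inhabited by a family with a LIVE operator direction

Cell `pub-balaban`, sub-cell `t4`, BINDER-OWNERS row NE1′; NE1′ formalisation crew, unit `b2b-balaban-t4-ne1p-formalise-leaf-03`
(LEAF PROVER 03, generation 13); crew row W54 ∕ DAG N29zzz of `t4/formal/NE1p/LEAVES.md` (INTENT journal l.20259, BOOKED typer R-T129
(i) l.20308, (D1) two parts; X-read X173).  ADDITIVE — imports S42 `Spine/NE1p/DressedJointAnalyticOnCores` (p233022; → S33 → N0r∕N0q∕
N0p∕N0n, row NE5's `OutputRateOpGaussianParam` ∕ `B13TermParamGaussianBi{,Prod}`) and the unit's own W51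
`Spine/NE1p/DressedSourceAnalyticWitness` (p232342; → W35 `DressedSmallFieldCoresMassWitness` → W33 `DressedSmallFieldCoresWitness`, W24
`DressedSmallFieldTorusWitness`; W51's table-radius lemma `hH_pencil` is REUSED by name in Part 2 — the gate's `dedup.landed` forbids a
copy) ONLY; the new declarations are toy DATA (`def`, marked) and theorems; nothing of S42 ∕ S33 ∕ N0n–N0r ∕ W33 ∕ W35 ∕ W51 ∕ W24 ∕ row
NE5 is restated — used BY NAME.  Part 2
(`DressedJointAnalyticWitnessEnd`) fires S42 §4's joint (operator datum, source) END on W33's periodic-carrier sockets with (B3) met at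
the o-UNIFORM letters and shows the dressed OUTPUT moves in the operator direction.

WHY (R-T61 (ii), file and line).  S42 turned row NE5's displayed `TermLineAnalytic` for core families and N0n's joint (operator,
source) face into THEOREMS of the Gaussian letters, whose operator-HOLOMORPHY clauses are `DressedJointAnalyticOnCores` l.88 `hN_hol`,
l.91 `hq_hol` (§1), l.146 ∕ l.151 (§2), l.240 ∕ l.245 (§4) (the same clauses sit in N0p∕N0q∕N0r∕S33's `hN`∕`hq` blocks).  Every
decided `BiCore` in the tree has CONSTANT letters — W33 `DressedSmallFieldCoresWitness.coreW` l.116–117 (`N := 1`, `q := ‖v‖²`), W41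
`DressedSmallFieldDepCoresWitness` l.105–106, W40 `DressedSmallFieldSlotWitness.ℓW` l.118–119 («the operator-letter blocks are
discharged for CONSTANT toy letters only», its header l.51), NE5's `B13AssemblyCoresEndWitness` l.122–123 — so those clauses have so
far been met only by `differentiableOn_const`, and no applier moved the operator direction; NE5's one live-operator toy
(`OutputRateOpGaussianParamWitness.toyQ` l.56, `(1 + o)·‖v‖²`) is a `toyParamTerm`, not a `BiCore`, and never meets S42.
THIS FILE: §1 the LIVE letters (toy DATA) `NJ o p := 1 + o∕2`, `qJ o p v := (1 + o∕4)·‖v‖²` with `NJ_live` ∕ `qJ_live` (NOT constant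
in `o`), entire in `o` (`differentiable_NJ` ∕ `differentiable_qJ` — genuine derivatives), `‖N‖ ≤ N₀ = 2` and the margin `½‖v‖² − 0 ≤
Re q` on W33's letter ball `‖o‖ < 2`, joint measurability; §2 the core `coreJ c r hr` = W33's `coreW` (Dirac parameter mass, Cauchy
weight `c`, contour `τ = r` ON the circle, read-out READING the table through `VppCLMM`) with the letters REPLACED by `NJ`∕`qJ`, and
the family `coreFamJ`; §3 the letter blocks `hN_J` ∕ `hq_J` in S42's literal three-clause shape on `ball (ctr0 k g U).1 2`, the
holomorphy clauses by `Differentiable.differentiableOn` of the affine letters; §4 **S42 §1 FIRES** (`jointEnd_fires`: `(o, h) ↦ termAt o h`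
Fréchet-holomorphic on `{‖o‖ < 2} ×ˢ ball 0 R_H`) and **S42 §2 FIRES** (`lineEnd_fires`: `TermLineAnalytic (ballClass ctr0 1 2) (fun k i
o h X => (coreFamJ c r hr k i X).termAt o h) univ` — conclusion LITERALLY NE5's shape); §5 GENUINE: `termAt o 0 = c·(1 + o∕2)·∫ e^{−(1
+ o∕4)‖v‖²}` (`termAt_table_zero`), at real `t > −4` `= c·(1 + t∕2)·√(π∕(1 + t∕4))` by Mathlib's `GaussianFourier.integral_rexp_neg_mul_sq_norm`
(`termAt_table_zero_real`; the toy's Gaussian, not a fluctuation covariance of print), hence `termAt 0 0 = c√π ≠ c·(5∕4)·√(8π∕9) =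
termAt ½ 0` for `c ≠ 0` (`termAt_op_live`, `√π < √(25π∕18)`); both data lie in the CLOSED class ball `‖o‖ ≤ 1` and the operator segment
`ζ ↦ (0 + ζ·½, 0 + ζ·0)` is an admissible line of `TermLineAnalytic` (`opSegment_mem_ballClass`) along which the term is NOT constant
(`lineEnd_live`).

HONEST FRAMING.  A DECIDED TOY of NE5's witness KIND: `NJ`, `qJ`, `coreJ`, `c`, `r` are DECLARED toy letters ∕ data, not Bałaban's
(2.14) data (no Gaussian volume, covariance or contour of [Balaban1988RGII] is computed); (B1a) kernel as in S42 — a relocation onto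
the Gaussian LETTER hypotheses whose identification with Bałaban's (2.14) is the substrate's DISPLAYED reading (NE5 LEAVES class W), NOT
claimed; (B1b)'s residue, (B3) = `hM3` (G-ne9p2-5 UNPRINTED, shared with NE9), the clause SHAPES and `hH` stay DISPLAYED in the faces;
no numeral of print; 0 binders instantiated on Bałaban's densities; no new inequality; no wall item of NE1′ or NE5 moves; wall v1.7
(T4-DAG v46) does NOT move; R-t4r2-Q2 NOT met.  NE1′ ⇐ the named binders — NOT proved, NOT printed; spine PROVED 0∕9; count 9 unchanged.
Rung (B)+1 on ONE finite four-torus — NOT infinite volume, NOT a mass gap, NOT OS on ℝ⁴, NOT Clay.  HONEST DEPENDENCY: continuum YM on T⁴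
⇐ BetaPertH ∧ nine spine estimates (0/9 proved); BetaPertH ⇐ (D1) ∧ (D4) ∧ CAP+tail; G-an2-4 gates asym, D1 and NE2/3/4.
-/

noncomputable section

namespace Summit.QuantumFields.BalabanUV.T4Continuum.NE1p.DressedJointAnalyticWitness

open Set Metric MeasureTheory Complex
open scoped BigOperators
open Literature.MathematicalPhysics.QuantumFieldTheory.Balaban1983to89
open Literature.MathematicalPhysics.QuantumFieldTheory.Balaban1983to89.T4InputCauchyRateSpecies (ballClass)
open Literature.MathematicalPhysics.QuantumFieldTheory.Balaban1983to89.T4InputCauchyRateTermwise (TermLineAnalytic)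
open Summit.QuantumFields.BalabanUV.T4Continuum.B13HistDatum (level136)
open Summit.QuantumFields.BalabanUV.T4Continuum.B13HistMeasurable (B13HistM)
open Summit.QuantumFields.BalabanUV.T4Continuum.B13HistWitness (toyFrame level136_toyFrame)
open Summit.QuantumFields.BalabanUV.T4Continuum.B13TermParamGaussianBi (BiCore)
open Summit.QuantumFields.BalabanUV.T4Continuum.InsertionLinearClass (linToyCarriers)
open Summit.QuantumFields.BalabanUV.T4Continuum.NE1p.DressedSmallFieldCoresWitness (E1 liveTable VppM_liveTable
  norm_liveTable_le crd measurable_crd ctr0 hroom0 Acst Acst_pos)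
open Summit.QuantumFields.BalabanUV.T4Continuum.NE1p.DressedSmallFieldCoresMassWitness (finrank_E1)
open Summit.QuantumFields.BalabanUV.T4Continuum.NE1p.DressedJointAnalyticOnCores (differentiableOn_termAt_joint
  termLineAnalytic_termAt)

/-! ## §1 THE LIVE OPERATOR LETTERS (toy DATA): `N(o, p) := 1 + o∕2`, `q(o, p, v) := (1 + o∕4)·‖v‖²` -/

/-- NORMALISATION LETTER READ OFF THE OPERATOR DATUM (toy DATA): `N(o, p) := 1 + o∕2` — an entire, NON-CONSTANT function of the
operator datum `o ∈ ℂ` (NE5's DECLARED toy-letter KIND; not a Gaussian volume of print). [folklore] -/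
def NJ : ℂ → Unit → ℂ := fun o _ => 1 + o / 2

/-- EXPONENT LETTER READ OFF THE OPERATOR DATUM (toy DATA): `q(o, p, v) := (1 + o∕4)·‖v‖²` — NE5's own
`OutputRateOpGaussianParamWitness.toyQ` KIND (a complex «covariance» `1 + o∕4`), NON-CONSTANT in `o`. [folklore] -/
def qJ : ℂ → Unit → E1 → ℂ := fun o _ v => (1 + o / 4) * ((‖v‖ ^ 2 : ℝ) : ℂ)

/-- **THE NORMALISATION LETTER IS LIVE IN THE OPERATOR DATUM**: `N(0) = 1 ≠ 3∕2 = N(1)`. [folklore] -/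
theorem NJ_live : NJ 0 () ≠ NJ 1 () := by unfold NJ; norm_num

/-- **THE EXPONENT LETTER IS LIVE IN THE OPERATOR DATUM**: `q(0, v) = ‖v‖² ≠ (5∕4)‖v‖² = q(1, v)` for `v ≠ 0`. [folklore] -/
theorem qJ_live {v : E1} (hv : v ≠ 0) : qJ 0 () v ≠ qJ 1 () v := by
  unfold qJ
  have h : ((‖v‖ ^ 2 : ℝ) : ℂ) ≠ 0 := by exact_mod_cast (pow_pos (norm_pos_iff.2 hv) 2).ne'
  intro heq
  have h2 := mul_right_cancel₀ h heq
  norm_num at h2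

/-- `o ↦ N(o, p)` is entire (affine). [folklore] -/
theorem differentiable_NJ (p : Unit) : Differentiable ℂ fun o => NJ o p := by unfold NJ; fun_prop

/-- `o ↦ q(o, p, v)` is entire (affine). [folklore] -/
theorem differentiable_qJ (p : Unit) (v : E1) : Differentiable ℂ fun o => qJ o p v := by unfold qJ; fun_prop

/-- THE LETTER `N₀ = 2` on the letter ball `‖o‖ < 2`: `‖1 + o∕2‖ ≤ 1 + ‖o‖∕2 ≤ 2`. [folklore] -/
theorem norm_NJ_le {o : ℂ} (ho : o ∈ ball (0 : ℂ) 2) (p : Unit) : ‖NJ o p‖ ≤ 2 := by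
  unfold NJ
  rw [mem_ball_zero_iff] at ho
  calc ‖1 + o / 2‖ ≤ ‖(1 : ℂ)‖ + ‖o / 2‖ := norm_add_le _ _
    _ = 1 + ‖o‖ / 2 := by rw [norm_one, norm_div, Complex.norm_ofNat]
    _ ≤ 2 := by linarith

/-- `Re q(o, p, v) = (1 + Re o∕4)·‖v‖²`. [folklore] -/
theorem re_qJ (o : ℂ) (p : Unit) (v : E1) : (qJ o p v).re = (1 + o.re / 4) * ‖v‖ ^ 2 := by
  unfold qJ
  rw [Complex.re_mul_ofReal, Complex.add_re, Complex.one_re, Complex.div_ofNat_re]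

/-- THE MARGIN `mq = ½`, `bq = 0` on the letter ball `‖o‖ < 2`: `½‖v‖² − 0 ≤ Re q(o, p, v)` (`Re o > −2`). [folklore] -/
theorem qJ_margin {o : ℂ} (ho : o ∈ ball (0 : ℂ) 2) (p : Unit) (v : E1) : 1 / 2 * ‖v‖ ^ 2 - 0 ≤ (qJ o p v).re := by
  rw [re_qJ, sub_zero]
  refine mul_le_mul_of_nonneg_right ?_ (sq_nonneg _)
  rw [mem_ball_zero_iff] at ho
  have h := (abs_le.1 (Complex.abs_re_le_norm o)).1
  linarith

/-- Joint measurability of `(p, v) ↦ q(o, p, v)` on `Unit × E1`. [folklore] -/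
theorem measurable_qJ_uncurry (o : ℂ) : Measurable (Function.uncurry (qJ o)) := by
  have h : Measurable fun z : Unit × E1 => ((‖z.2‖ ^ 2 : ℝ) : ℂ) :=
    Complex.measurable_ofReal.comp (measurable_snd.norm.pow_const 2)
  exact h.const_mul _

/-! ## §2 THE CORE WITH LIVE OPERATOR LETTERS (toy DATA) -/

/-- **THE CORE WITH LIVE OPERATOR LETTERS** (toy DATA) [decided toy]: W33's `coreW` (parameters `Unit` with the Dirac mass, Cauchy
weight the constant `c`, no χ-constraints, polymer family `{()}` at the carrier domain `0`, contour weight `τ := r` ON the circle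
`rad := r`, field map `B () v := v 0` — the read-out READS the table through `VppCLMM`) with the CONSTANT letters `N := 1`,
`q := ‖v‖²` REPLACED by the operator-dependent letters `NJ`, `qJ` of §1.  Not Bałaban's (2.14) data. [folklore] -/
def coreJ (c r : ℝ) (hr : 0 ≤ r) : BiCore toyFrame (fun _ : Unit => (0 : ℕ)) ℂ Unit E1 where
  lam := Measure.dirac ()
  finite := by infer_instance
  w := fun _ => (c : ℂ)
  measW := measurable_const
  wB := |c|
  norm_w_le := fun _ => by rw [Complex.norm_real, Real.norm_eq_abs]
  N := NJ
  q := qJ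
  cons := []
  nsign := 0
  D := {()}
  τ := fun _ _ => (r : ℂ)
  measτ := fun _ => measurable_const
  rad := fun _ => r
  rad_nonneg := fun _ => hr
  norm_τ_le := fun _ _ => by rw [Complex.norm_real, Real.norm_eq_abs, abs_of_nonneg hr]
  B := fun _ v => crd v
  measB := fun _ => measurable_crd

variable (c r : ℝ) (hr : 0 ≤ r)

/-- No constraints: the potential-free factor is `1`. [folklore] -/
theorem chi_coreJ (v : E1) : (coreJ c r hr).chi v = 1 := by unfold BiCore.chi BiCore.chiSet; simp [coreJ]

/-- THE READ-OUT READS THE TABLE: `readOut p v h = r·V″(h)(0, v 0)` (`readOut_apply` BY NAME). [folklore] -/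
theorem readOut_coreJ (p : Unit) (v : E1) (h : B13HistM toyFrame) :
    (coreJ c r hr).readOut p v h = (r : ℂ) * toyFrame.VppM h 0 (crd v) := by
  rw [BiCore.readOut_apply]; show ∑ Y ∈ ({()} : Finset Unit), (r : ℂ) * _ = _; rw [Finset.sum_singleton]; rfl

/-- … along the table pencil `s • liveTable`: `readOut p v (s • liveTable) = s·(r·e^{−(v 0)²})`. [folklore] -/
theorem readOut_coreJ_smul_liveTable (p : Unit) (v : E1) (s : ℂ) :
    (coreJ c r hr).readOut p v (s • liveTable) = s * ((r : ℂ) * (Real.exp (-(crd v ^ 2)) : ℂ)) := by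
  rw [map_smul, smul_eq_mul, readOut_coreJ, VppM_liveTable]

/-- The core's letter `N₁ = r·level136 = r`. [folklore] -/
theorem N₁_coreJ : (coreJ c r hr).N₁ = r := by
  unfold BiCore.N₁; show ∑ Y ∈ ({()} : Finset Unit), r * level136 toyFrame.consts (linToyCarriers.d 0) = r
  rw [Finset.sum_singleton, level136_toyFrame, mul_one]

/-- The constant core family (toy DATA): the live-letter core at every step, term index and carrier domain. [folklore] -/
def coreFamJ : ∀ (_ : ℕ) (_ : Unit), ℕ → BiCore toyFrame (fun _ : Unit => (0 : ℕ)) ℂ Unit E1 := fun _ _ _ => coreJ c r hr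

/-! ## §3 THE OPERATOR-LETTER BLOCKS `hN`∕`hq` ON W33's LETTER BALL `‖o‖ < 2` — the HOLOMORPHY CLAUSES BY GENUINE DERIVATIVES -/

/-- **THE `hN` BLOCK WITH A LIVE HOLOMORPHY CLAUSE**: on the letter ball `ball (ctr0 k g U).1 2 = {‖o‖ < 2}` the normalisation
letter is a.e.-strongly measurable in `p` (constant in `p`), HOLOMORPHIC IN `o` as the affine map `o ↦ 1 + o∕2` (NOT by
`differentiableOn_const`), and bounded by `N₀ = 2`. [folklore] -/
theorem hN_J (k : ℕ) (g : ℕ → ℝ) (U : Unit) (X : ℕ) (i : Unit) :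
    (∀ o ∈ ball (ctr0 k g U).1 (2 : ℝ), AEStronglyMeasurable ((coreFamJ c r hr k i X).N o) (coreFamJ c r hr k i X).lam) ∧
    (∀ p, DifferentiableOn ℂ (fun o => (coreFamJ c r hr k i X).N o p) (ball (ctr0 k g U).1 (2 : ℝ))) ∧
    (∀ o ∈ ball (ctr0 k g U).1 (2 : ℝ), ∀ p, ‖(coreFamJ c r hr k i X).N o p‖ ≤ 2) :=
  ⟨fun _ _ => aestronglyMeasurable_const, fun p => (differentiable_NJ p).differentiableOn, fun _ ho p => norm_NJ_le ho p⟩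

/-- **THE `hq` BLOCK WITH A LIVE HOLOMORPHY CLAUSE**: on the letter ball the exponent letter is jointly measurable in `(p, v)`,
HOLOMORPHIC IN `o` as the affine map `o ↦ (1 + o∕4)·‖v‖²`, with the affine margin `½‖v‖² − 0 ≤ Re q`. [folklore] -/
theorem hq_J (k : ℕ) (g : ℕ → ℝ) (U : Unit) (X : ℕ) (i : Unit) :
    (∀ o ∈ ball (ctr0 k g U).1 (2 : ℝ),
      AEStronglyMeasurable (Function.uncurry ((coreFamJ c r hr k i X).q o)) ((coreFamJ c r hr k i X).lam.prod volume)) ∧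
    (∀ p v, DifferentiableOn ℂ (fun o => (coreFamJ c r hr k i X).q o p v) (ball (ctr0 k g U).1 (2 : ℝ))) ∧
    (∀ o ∈ ball (ctr0 k g U).1 (2 : ℝ), ∀ p v, 1 / 2 * ‖v‖ ^ 2 - 0 ≤ ((coreFamJ c r hr k i X).q o p v).re) :=
  ⟨fun o _ => (measurable_qJ_uncurry o).aestronglyMeasurable, fun p v => (differentiable_qJ p v).differentiableOn,
    fun _ ho p v => qJ_margin ho p v⟩

/-! ## §4 S42 §1 AND §2 FIRE: joint holomorphy of the term in (operator datum, table); row NE5's `TermLineAnalytic` INHABITED by a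
family with a LIVE operator direction -/

/-- **S42 §1 `differentiableOn_termAt_joint` FIRES ON THE LIVE-LETTER CORE** [decided toy]: for every table radius `R_H`,
`(o, h) ↦ termAt o h` is complex (Fréchet-) differentiable on `{‖o‖ < 2} ×ˢ ball 0 R_H` — the operator-holomorphy clauses fed by the
affine letters' derivatives, margin `(½, 0)`, `N₀ = 2`.  Conclusion LITERAL. [folklore] -/
theorem jointEnd_fires (RH : ℝ) :
    DifferentiableOn ℂ (fun z : ℂ × B13HistM toyFrame => (coreJ c r hr).termAt z.1 z.2)
      (ball (0 : ℂ) 2 ×ˢ ball (0 : B13HistM toyFrame) RH) :=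
  differentiableOn_termAt_joint (coreJ c r hr) isOpen_ball (m := 1 / 2) (b := 0) (N₀ := 2) (by norm_num)
    (fun _ _ => aestronglyMeasurable_const) (fun p => (differentiable_NJ p).differentiableOn) (fun _ ho p => norm_NJ_le ho p)
    (fun o _ => (measurable_qJ_uncurry o).aestronglyMeasurable) (fun p v => (differentiable_qJ p v).differentiableOn)
    (fun _ ho p v => qJ_margin ho p v) RH

/-- **S42 §2 `termLineAnalytic_termAt` FIRES: ROW NE5's `TermLineAnalytic` ON THE BALL CLASS `(ctr0, 1, 2)` FOR THE LIVE-LETTER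
FAMILY** [decided toy] — the displayed binder `hline` of NE5's ENDs inhabited by a core family whose operator direction MOVES the
integrand (§7).  Conclusion LITERAL. [folklore] -/
theorem lineEnd_fires :
    TermLineAnalytic (ballClass ctr0 (fun _ => (1 : ℝ)) (fun _ => (2 : ℝ)))
      (fun k i o h X => (coreFamJ c r hr k i X).termAt o h) (Set.univ : Set (ℕ → ℝ)) :=
  termLineAnalytic_termAt (W := Set.univ) (ctr := ctr0) (ROp := fun _ => 1) (RHist := fun _ => 2) (R' := fun _ => 2)
    (coreFamJ c r hr) (m := fun _ _ _ => 1 / 2) (b := fun _ _ _ => 0) (N₀ := fun _ _ _ => 2) hroom0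
    (fun _ _ _ _ _ _ _ => by norm_num) (fun k g _ U X _ i => hN_J c r hr k g U X i) (fun k g _ U X _ i => hq_J c r hr k g U X i)

/-! ## §5 THE TERM AT TABLE `0` IN CLOSED FORM — and its dependence on the operator datum -/

/-- **THE TERM AT TABLE `0`**: `termAt o 0 = c·(1 + o∕2)·∫ e^{−(1 + o∕4)‖v‖²} dv` (Dirac mass out, `chi = 1`, read-out of the zero
table `= 0`). [folklore] -/
theorem termAt_table_zero (o : ℂ) :
    (coreJ c r hr).termAt o 0 = (c : ℂ) * (1 + o / 2) * ∫ v : E1, cexp (-((1 + o / 4) * ((‖v‖ ^ 2 : ℝ) : ℂ))) := by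
  unfold BiCore.termAt
  show ∫ p, (coreJ c r hr).w p * (coreJ c r hr).N o p *
      ∫ v, (coreJ c r hr).chi v * cexp ((coreJ c r hr).readOut p v 0) * cexp (-(coreJ c r hr).q o p v) ∂volume
        ∂(coreJ c r hr).lam = _
  simp_rw [chi_coreJ, map_zero, Complex.exp_zero, one_mul]
  show ∫ p, (c : ℂ) * NJ o p * ∫ v, cexp (-qJ o p v) ∂volume ∂(Measure.dirac ()) = _
  rw [integral_dirac]
  rfl

/-- The one-dimensional Gaussian with a parameter: `∫_{E1} e^{−b‖v‖²} = √(π∕b)` for `0 < b` (Mathlib, `finrank = 1`). [folklore] -/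
theorem gaussian_E1_param {b : ℝ} (hb : 0 < b) : ∫ v : E1, Real.exp (-(b * ‖v‖ ^ 2)) = Real.sqrt (Real.pi / b) := by
  have h := GaussianFourier.integral_rexp_neg_mul_sq_norm (V := E1) hb
  simp only [neg_mul, finrank_euclideanSpace, Fintype.card_fin, Nat.cast_one] at h
  rw [h, Real.sqrt_eq_rpow]

/-- **THE TERM AT TABLE `0` AND A REAL OPERATOR DATUM `t > −4` IN CLOSED FORM**: `termAt t 0 = c·(1 + t∕2)·√(π∕(1 + t∕4))`.
[folklore] -/
theorem termAt_table_zero_real {t : ℝ} (ht : -4 < t) :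
    (coreJ c r hr).termAt (t : ℂ) 0 = (c : ℂ) * (((1 + t / 2) * Real.sqrt (Real.pi / (1 + t / 4)) : ℝ) : ℂ) := by
  rw [termAt_table_zero]
  have hb : 0 < 1 + t / 4 := by linarith
  have hI : ∫ v : E1, cexp (-((1 + (t : ℂ) / 4) * ((‖v‖ ^ 2 : ℝ) : ℂ))) =
      ((Real.sqrt (Real.pi / (1 + t / 4)) : ℝ) : ℂ) := by
    rw [← gaussian_E1_param hb, ← integral_complex_ofReal]
    refine integral_congr_ae (Filter.Eventually.of_forall fun v => ?_)
    show cexp _ = ((Real.exp _ : ℝ) : ℂ)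
    rw [Complex.ofReal_exp]
    push_cast
    ring_nf
  rw [hI]
  push_cast
  ring

/-- At the class centre `o = 0`: `termAt 0 0 = c·√π`. [folklore] -/
theorem termAt_zero_zero : (coreJ c r hr).termAt 0 0 = (c : ℂ) * ((Real.sqrt Real.pi : ℝ) : ℂ) := by
  have h := termAt_table_zero_real c r hr (t := 0) (by norm_num)
  rw [Complex.ofReal_zero] at h
  rw [h]
  norm_num

/-- At the operator datum `o = ½` (inside the class ball `‖o‖ ≤ 1`): `termAt ½ 0 = c·(5∕4)·√(8π∕9)`. [folklore] -/
theorem termAt_half_zero : (coreJ c r hr).termAt (1 / 2) 0 = (c : ℂ) * (((5 / 4) * Real.sqrt (8 * Real.pi / 9) : ℝ) : ℂ) := by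
  have h := termAt_table_zero_real c r hr (t := 1 / 2) (by norm_num)
  have e : ((1 / 2 : ℝ) : ℂ) = 1 / 2 := by push_cast; ring
  rw [e] at h
  rw [h, show Real.pi / (1 + 1 / 2 / 4) = 8 * Real.pi / 9 by ring]
  norm_num

/-- **GENUINE — THE TERM IS NOT CONSTANT IN THE OPERATOR DATUM** [decided toy]: for `c ≠ 0`, `termAt 0 0 ≠ termAt ½ 0`
(`√π < (5∕4)·√(8π∕9) = √(25π∕18)`).  Both operator data lie in the CLOSED class ball `‖o‖ ≤ 1` of `ballClass ctr0 1 2`, so the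
segment `ζ ↦ (0 + ζ·½, 0 + ζ·0)` is an admissible line of `TermLineAnalytic` along which the term of §4 is NOT constant. [folklore] -/
theorem termAt_op_live (hc : c ≠ 0) : (coreJ c r hr).termAt 0 0 ≠ (coreJ c r hr).termAt (1 / 2) 0 := by
  rw [termAt_zero_zero, termAt_half_zero]
  intro h
  have hc' : (c : ℂ) ≠ 0 := by exact_mod_cast hc
  have h1 : ((Real.sqrt Real.pi : ℝ) : ℂ) = (((5 / 4) * Real.sqrt (8 * Real.pi / 9) : ℝ) : ℂ) := mul_left_cancel₀ hc' h
  have h2 : Real.sqrt Real.pi = 5 / 4 * Real.sqrt (8 * Real.pi / 9) := by exact_mod_cast h1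
  have h3 : Real.sqrt Real.pi < 5 / 4 * Real.sqrt (8 * Real.pi / 9) := by
    rw [show (5 / 4 : ℝ) = Real.sqrt ((5 / 4) ^ 2) by rw [Real.sqrt_sq (by norm_num)],
      ← Real.sqrt_mul (by norm_num) (8 * Real.pi / 9)]
    exact Real.sqrt_lt_sqrt Real.pi_pos.le (by nlinarith [Real.pi_pos])
  exact h3.ne h2

/-- The operator segment from the class centre in the direction `u = ½` (table direction `0`) has its closed unit part inside the
ball class `(ctr0, 1, 2)` — it IS a line of `TermLineAnalytic`. [folklore] -/
theorem opSegment_mem_ballClass (k : ℕ) (g : ℕ → ℝ) (U : Unit) :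
    ∀ ζ ∈ closedBall (0 : ℂ) 1, ((0 : ℂ) + ζ • (1 / 2 : ℂ), (0 : B13HistM toyFrame) + ζ • (0 : B13HistM toyFrame)) ∈
      ballClass ctr0 (fun _ => (1 : ℝ)) (fun _ => (2 : ℝ)) k g U := by
  intro ζ hζ
  refine Set.mk_mem_prod (mem_closedBall.2 ?_) (mem_closedBall.2 ?_)
  · show dist ((0 : ℂ) + ζ • (1 / 2 : ℂ)) 0 ≤ 1
    rw [dist_zero_right, zero_add, norm_smul]
    have h1 : ‖ζ‖ ≤ 1 := mem_closedBall_zero_iff.1 hζ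
    have h2 : ‖(1 / 2 : ℂ)‖ = 1 / 2 := by rw [norm_div, norm_one, Complex.norm_ofNat]
    rw [h2]; linarith [norm_nonneg ζ]
  · show dist ((0 : B13HistM toyFrame) + ζ • (0 : B13HistM toyFrame)) 0 ≤ 2
    rw [smul_zero, add_zero, dist_self]; norm_num

/-- **ROW NE5's `TermLineAnalytic` IS INHABITED NON-TRIVIALLY**: along the admissible operator line of `opSegment_mem_ballClass` the
term family of `lineEnd_fires` takes DIFFERENT values at `ζ = 0` and `ζ = 1` (for `c ≠ 0`). [folklore] -/
theorem lineEnd_live (hc : c ≠ 0) (k : ℕ) (i : Unit) (X : ℕ) :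
    (fun k i o h X => (coreFamJ c r hr k i X).termAt o h) k i ((0 : ℂ) + (0 : ℂ) • (1 / 2 : ℂ))
        ((0 : B13HistM toyFrame) + (0 : ℂ) • (0 : B13HistM toyFrame)) X ≠
      (fun k i o h X => (coreFamJ c r hr k i X).termAt o h) k i ((0 : ℂ) + (1 : ℂ) • (1 / 2 : ℂ))
        ((0 : B13HistM toyFrame) + (1 : ℂ) • (0 : B13HistM toyFrame)) X := by
  simp only [zero_smul, one_smul, smul_zero, add_zero, zero_add]
  exact termAt_op_live c r hr hc
/-! ## §6 SOCKETS FOR PART 2: the weight meeting the o-UNIFORM letter budget and the letter Gaussian at `mq = ½` (the table radius of the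
source pencil is W51's `hH_pencil`, reused BY NAME in Part 2) -/

/-- The Cauchy weight meeting the o-UNIFORM letter budget: `cJ := A·e^{−2r}∕(4√π)`, `A = (e·K₀(64,8)·9·64)⁻¹` W24's located
constant (toy DATA) — the `4√π` is `N₀·(π∕(mq∕2))^{1∕2} = 2·2√π` at the live letters' bounds `(N₀, mq) = (2, ½)`. [folklore] -/
def cJ (r : ℝ) : ℝ := Acst * Real.exp (-(2 * r)) / (4 * Real.sqrt Real.pi)

/-- `0 < cJ`. [folklore] -/
theorem cJ_pos (r : ℝ) : 0 < cJ r := by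
  unfold cJ; have := Acst_pos; have := Real.exp_pos (-(2 * r)); have := Real.sqrt_pos.2 Real.pi_pos; positivity

/-- `(π∕(½∕2))^{(dim E1)∕2} = √(4π) = 2√π` — the letter Gaussian at the margin `mq = ½`. [folklore] -/
theorem letterGauss_J : (Real.pi / ((1 / 2 : ℝ) / 2)) ^ (Module.finrank ℝ E1 / 2 : ℝ) = 2 * Real.sqrt Real.pi := by
  rw [finrank_E1, Nat.cast_one, show Real.pi / ((1 / 2 : ℝ) / 2) = 2 ^ 2 * Real.pi by ring, ← Real.sqrt_eq_rpow,
    Real.sqrt_mul (by norm_num), Real.sqrt_sq (by norm_num)]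


end Summit.QuantumFields.BalabanUV.T4Continuum.NE1p.DressedJointAnalyticWitness

end
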